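import Summits.AtomisticToContinuum.Crystallization.Theorems.FluxTubeKeplerFloorGivesLayered
import Summits.AtomisticToContinuum.Crystallization.Theorems.FluxTubeKeplerFluxCellKeplerSingleScale
import Summits.AtomisticToContinuum.Crystallization.Theorems.ChessboardParticlePlanesPeriodicWindowsIffCrystallization
import Literature.Barriers.AtomisticToContinuum.IcosahedralClusters

/-!
# G28 — forward rung generator over `FluxTubeKepler.FloorGivesLayered`: the SUBSIDY dial
# (banked Sketch for the census `Lines/G28FoundNothing.md`; NOT a registered line)

Crux `stmt-AtomisticToContinuum-15221` (`FluxTubeKepler.FluxCellKepler`), seed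
g1-AtomisticToContinuum-15223 = `Theorems.FluxTubeKeplerFloorGivesLayered.FloorGivesLayered_proof`
(FLOOR(P₀) ∧ layered-defect BUDGET at every scale ⇒ layered windows), forward generator G1, generation 28.

Every registered rung over this floor (gens 1–16, 18, 21) RELAXES the budget by un-pricing a class of bad
sites (price `0`) or by changing the currency / rate / test class.  This seat's candidate is the one move on
the SIGN of the price: the certificate may MIS-price the known local minimiser of the one-centre functional —
the thirteen-atom icosahedral star (`Literature.Barriers.AtomisticToContinuum.IcosahedralClusters`: one-centre
`λ_ico ≈ -0.76 < λ_fcc ≈ -0.7254`, the recorded obstruction #1 of the crux) — by a NEGATIVE amount: every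
`(1/20)`-icosahedral centre may offset `κ` units of defect charge,

  `SubsidyBudget κ P₀ :  ∀ R η > 0, ∃ c > 0, ∀ N x GS,  c · #bad(R,η,x) ≤ (E(x) − N·e(P₀)) + κ · #ico(x)`.

`κ = 0` is the floor's budget (F3, `subsidyRung_zero`, one rewriting `zero_mul`/`add_zero`); all `κ > 0` are
EQUIVALENT under FLOOR (`subsidyRung_pos_iff`: rescale `c`), so the dial has exactly two members and no hand-picked
threshold (typing checklist 4c(iv)); the rung is `IcoSubsidyRung := SubsidyRung 1`; `S ⇒` every member (F4,
`IcoSubsidyRung_of_Crystallization`).  Why the floor's proof stops: `c` is existential, so with `#ico = θN` and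
`c ≤ κθ` the subsidised budget permits EVERY site to be bad at every scale — Step 1 (`eventually_exists_not_bad`)
has nothing to count; the restoring input would be "icosahedral centres have density `→ 0` along Lennard-Jones
ground-state sequences", an averaged SHARP-constant transfer inequality for icosahedral stars on ground states.
Verdict of the seat's critic: non-flat, on-path, floor-specialising, not a registered dial — but predicted tier C
(Attack 2, Barriers 2: the restoring input is `TetrahedralFrustration` head-on, census class G22-X12b); NOT filed.
No `sorry`.
-/

noncomputable section

open scoped BigOperators Classical
open Filter Topology

namespace Summit.AtomisticToContinuum.Crystallization.Cruxes.FluxCellKepler.SubsidyLadder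

open Literature.MathematicalPhysics.StatisticalMechanics
open Summit.AtomisticToContinuum.Crystallization.Theorems.FluxCellKeplerSingleScale (LayeredGood)
open Literature.Barriers.AtomisticToContinuum (icosahedralCluster)

local notation "E3" => EuclideanSpace ℝ (Fin 3)

/-! ## The subsidy ladder -/

/-- FLOOR(P₀): `N · e(P₀) ≤ E(x)` for every Lennard-Jones ground state `x` of every size `N`
(verbatim the first hypothesis of `FluxTubeKepler.FloorGivesLayered`). -/
def Floor (P₀ : PeriodicConfiguration 3) : Prop :=
  ∀ (N : ℕ) (x : Fin N → E3), IsGroundState lennardJones x →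
    (N : ℝ) * P₀.energyPerParticle lennardJones ≤ interactionEnergy lennardJones x

/-- The subsidised class `U`: site `i` is a `(1/20)`-ICOSAHEDRAL CENTRE — its relative configuration out to
radius `(11/10)·r` is two-way `(1/20)`-matched to a rigid copy of the scaled rational icosahedral thirteen-cluster
`r • icosahedralCluster` (`Literature.Barriers.AtomisticToContinuum.IcosahedralClusters`, centre `0`, shell radius
`√34/6 · r`), for some scale `r ∈ [9/10, 1]`. -/
def IcoCentre {N : ℕ} (x : Fin N → E3) (i : Fin N) : Prop :=
  ∃ r : ℝ, 9 / 10 ≤ r ∧ r ≤ 1 ∧ ∃ A : E3 →ₗᵢ[ℝ] E3,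
    (∀ k : Fin 13, ∃ j : Fin N, dist (x j - x i) (A (r • icosahedralCluster k)) ≤ 1 / 20) ∧
    (∀ j : Fin N, ‖x j - x i‖ ≤ 11 / 10 * r →
      ∃ k : Fin 13, dist (x j - x i) (A (r • icosahedralCluster k)) ≤ 1 / 20)

/-- SUBSIDISED BUDGET(κ, P₀): at every scale `(R, η)` some `c > 0` prices the `(R,η)`-non-layered sites of every
ground state against the excess energy over `N · e(P₀)` PLUS a subsidy of `κ` per icosahedral centre. -/
def SubsidyBudget (κ : ℝ) (P₀ : PeriodicConfiguration 3) : Prop :=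
  ∀ R η : ℝ, 0 < R → 0 < η → ∃ c : ℝ, 0 < c ∧
    ∀ (N : ℕ) (x : Fin N → E3), IsGroundState lennardJones x →
      c * (Nat.card {i : Fin N // ¬ LayeredGood R η x i} : ℝ) ≤
        (interactionEnergy lennardJones x - (N : ℝ) * P₀.energyPerParticle lennardJones)
          + κ * (Nat.card {i : Fin N // IcoCentre x i} : ℝ)

/-- Periodic windows at every scale along the sequence `x` (one periodic `P`, translations only) — verbatim the
conclusion of `FluxTubeKepler.PeriodicGivenLayered` / `ChessboardParticlePlanes.PeriodicWindows`. -/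
def HasPeriodicWindows (x : (N : ℕ) → (Fin N → E3)) : Prop :=
  ∃ P : PeriodicConfiguration 3, ∀ R ε : ℝ, 0 < ε → ∃ᶠ N in atTop, ∃ t : E3,
    (∀ s ∈ P.points, ‖s‖ ≤ R → ∃ i : Fin N, dist (x N i + t) s ≤ ε) ∧
    (∀ i : Fin N, ‖x N i + t‖ ≤ R → ∃ s ∈ P.points, dist (x N i + t) s ≤ ε)

/-- `SubsidyRung κ`: FLOOR and the `κ`-subsidised defect budget force periodic windows along every Lennard-Jones
ground-state sequence. -/
def SubsidyRung (κ : ℝ) : Prop :=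
  ∀ P₀ : PeriodicConfiguration 3, Floor P₀ → SubsidyBudget κ P₀ →
    ∀ x : (N : ℕ) → (Fin N → E3), (∀ N, IsGroundState lennardJones (x N)) → HasPeriodicWindows x

/-- **The g28 candidate rung**: icosahedral centres may be over-credited by one unit of defect charge each. -/
def IcoSubsidyRung : Prop := SubsidyRung 1

/-! ## F3 — the family specialises to the proved floor (`κ = 0`) -/

/-- `SubsidyRung 0` is the floor followed by the proved `PeriodicGivenLayered`; the only rewriting is
`0 * #ico = 0`. -/
theorem subsidyRung_zero : SubsidyRung 0 := by
  intro P₀ hF hB x hx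
  refine Theses.FluxTubeKepler.PeriodicGivenLayered_holds x hx
    (Theorems.FluxTubeKeplerFloorGivesLayered.FloorGivesLayered_proof P₀ hF (fun R η hR hη => ?_) x hx)
  obtain ⟨c, hc, hcb⟩ := hB R η hR hη
  refine ⟨c, hc, fun N y hy => ?_⟩
  have h := hcb N y hy
  have h' : c * (Nat.card {i : Fin N // ¬ LayeredGood R η y i} : ℝ) ≤
      interactionEnergy lennardJones y - (N : ℝ) * P₀.energyPerParticle lennardJones := by
    simpa only [zero_mul, add_zero] using h
  exact h'

/-! ## The dial: monotone in `κ`, and all positive `κ` are one rung -/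

/-- A larger subsidy is a weaker budget. -/
theorem subsidyBudget_mono {κ κ' : ℝ} (h : κ ≤ κ') {P₀ : PeriodicConfiguration 3} :
    SubsidyBudget κ P₀ → SubsidyBudget κ' P₀ := by
  intro hB R η hR hη
  obtain ⟨c, hc, hcb⟩ := hB R η hR hη
  refine ⟨c, hc, fun N x hx => (hcb N x hx).trans ?_⟩
  have hU : (0 : ℝ) ≤ (Nat.card {i : Fin N // IcoCentre x i} : ℝ) := by positivity
  nlinarith

/-- Antitonicity of the dial: more subsidy assumed = stronger rung. -/
theorem subsidyRung_anti {κ κ' : ℝ} (h : κ ≤ κ') : SubsidyRung κ' → SubsidyRung κ :=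
  fun H P₀ hF hB x hx => H P₀ hF (subsidyBudget_mono h hB) x hx

/-- Every member with `κ ≥ 0` gives the floor member. -/
theorem subsidyRung_zero_of {κ : ℝ} (hκ : 0 ≤ κ) : SubsidyRung κ → SubsidyRung 0 :=
  subsidyRung_anti hκ

/-- Under FLOOR the excess is non-negative, so the pricing constant can be RESCALED: every two positive subsidies
define the same budget up to the existential `c`.  Hence the dial has exactly two members, `κ = 0` (the floor)
and `κ > 0` (the rung) — no hand-picked threshold. -/
theorem subsidyBudget_of_pos {κ κ' : ℝ} (hκ : 0 < κ) (hκ' : 0 < κ') {P₀ : PeriodicConfiguration 3}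
    (hF : Floor P₀) : SubsidyBudget κ P₀ → SubsidyBudget κ' P₀ := by
  intro hB R η hR hη
  obtain ⟨c, hc, hcb⟩ := hB R η hR hη
  -- rescale by `t = min 1 (κ'/κ) ∈ (0, 1]`
  set t : ℝ := min 1 (κ' / κ) with ht
  have ht0 : 0 < t := lt_min one_pos (div_pos hκ' hκ)
  have ht1 : t ≤ 1 := min_le_left _ _
  have htκ : t * κ ≤ κ' := by
    have : t ≤ κ' / κ := min_le_right _ _
    calc t * κ ≤ κ' / κ * κ := by nlinarith
      _ = κ' := by field_simp
  refine ⟨t * c, mul_pos ht0 hc, fun N x hx => ?_⟩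
  have hX : 0 ≤ interactionEnergy lennardJones x - (N : ℝ) * P₀.energyPerParticle lennardJones :=
    sub_nonneg.mpr (hF N x hx)
  have hU : (0 : ℝ) ≤ (Nat.card {i : Fin N // IcoCentre x i} : ℝ) := by positivity
  have hB0 : (0 : ℝ) ≤ (Nat.card {i : Fin N // ¬ LayeredGood R η x i} : ℝ) := by positivity
  have h := hcb N x hx
  -- `t·c·#bad ≤ t·X + t·κ·#ico ≤ X + κ'·#ico`
  have h1 : t * (c * (Nat.card {i : Fin N // ¬ LayeredGood R η x i} : ℝ)) ≤
      t * ((interactionEnergy lennardJones x - (N : ℝ) * P₀.energyPerParticle lennardJones)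
        + κ * (Nat.card {i : Fin N // IcoCentre x i} : ℝ)) :=
    mul_le_mul_of_nonneg_left h ht0.le
  have h2 : t * (interactionEnergy lennardJones x - (N : ℝ) * P₀.energyPerParticle lennardJones)
      ≤ interactionEnergy lennardJones x - (N : ℝ) * P₀.energyPerParticle lennardJones := by
    nlinarith
  have h3 : t * (κ * (Nat.card {i : Fin N // IcoCentre x i} : ℝ))
      ≤ κ' * (Nat.card {i : Fin N // IcoCentre x i} : ℝ) := by
    nlinarith
  calc t * c * (Nat.card {i : Fin N // ¬ LayeredGood R η x i} : ℝ)
      = t * (c * (Nat.card {i : Fin N // ¬ LayeredGood R η x i} : ℝ)) := by ring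
    _ ≤ _ := h1
    _ = t * (interactionEnergy lennardJones x - (N : ℝ) * P₀.energyPerParticle lennardJones)
          + t * (κ * (Nat.card {i : Fin N // IcoCentre x i} : ℝ)) := by ring
    _ ≤ _ := add_le_add h2 h3

/-- **All positive subsidies are one rung.** -/
theorem subsidyRung_pos_iff {κ κ' : ℝ} (hκ : 0 < κ) (hκ' : 0 < κ') : SubsidyRung κ ↔ SubsidyRung κ' :=
  ⟨fun H P₀ hF hB x hx => H P₀ hF (subsidyBudget_of_pos hκ' hκ hF hB) x hx,
   fun H P₀ hF hB x hx => H P₀ hF (subsidyBudget_of_pos hκ hκ' hF hB) x hx⟩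

/-- The rung gives the floor member. -/
theorem subsidyRung_zero_of_icoSubsidyRung (h : IcoSubsidyRung) : SubsidyRung 0 :=
  subsidyRung_zero_of zero_le_one h

/-- The rung gives every member. -/
theorem subsidyRung_of_icoSubsidyRung (h : IcoSubsidyRung) (κ : ℝ) : SubsidyRung κ := by
  by_cases hκ : κ ≤ 0
  · exact subsidyRung_anti hκ (subsidyRung_zero_of_icoSubsidyRung h)
  · exact (subsidyRung_pos_iff one_pos (lt_of_not_ge hκ)).1 h

/-! ## F4 — on path -/

/-- `Crystallization → SubsidyRung κ` for every `κ` (landed hull-criterion converse; the hypotheses are not used). -/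
theorem subsidyRung_of_crystallization (κ : ℝ) (h : _root_.Crystallization) : SubsidyRung κ :=
  fun _ _ _ x hx =>
    Theorems.ChessboardParticlePlanesPeriodicWindowsIffCrystallization.periodicWindows_of_crystallization h x hx

@[aesop safe apply]
theorem IcoSubsidyRung_of_Crystallization (h : _root_.Crystallization) : IcoSubsidyRung :=
  subsidyRung_of_crystallization 1 h

end Summit.AtomisticToContinuum.Crystallization.Cruxes.FluxCellKepler.SubsidyLadder

end
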